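import Summits.AtomisticToContinuum.Crystallization.Theorems.ReggeStarCoercivityStarCoercivityCoarseTierTransfer

/-!
# Route `GappedShellCensus`, crux `RadialDefectsVanish` (stmt-AtomisticToContinuum-15930),
# line `Sketch`: stub `stub_rdvGappedIff` — gapped-twelve status, periodisation ↔ finite

For a periodic configuration `P` of `ℝ³` with motif `univ.image x` (`x : Fin N → ℝ³` injective)
all of whose non-zero periods have length `≥ 2Σ‖x k‖ + 2`, and a scale `0 < a ≤ 1`, the
"gapped-twelve" status of the site `x i` READ IN THE INFINITE POINT SET `P.points` (exactly
twelve other points at distance `≤ 1.02a`, none closer than `0.98a`, none in the open annulus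
`(1.02a, 1.26a)`) coincides with its status READ IN `x` (the same clauses over the indices
`j ≠ i`).

PROOF.  The points of `P` other than the `x j` are at distance `≥ 2` from every `x i`
(`CoarseTierTransfer.two_le_dist_of_mem_points`), and `2 > 1.26 ≥ 63a/50 > 1.02a ≥ a(1+1/50)`,
`2 ≥ a(1-1/50)`.  Hence (1) the shell set `{w ∈ P.points | w ≠ x i ∧ dist (x i) w ≤ 1.02a}` is
the image under `x` of the index shell `{j ≠ i | dist (x i) (x j) ≤ 1.02a}` (the `x j` are points
of `P`, `P.mem_points_of_mem_motif`; `x j ≠ x i ↔ j ≠ i` by injectivity), so its `ncard` is the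
index-shell cardinality (`Set.ncard_coe_finset`, `Finset.card_image_of_injective`); and (2) the
two `∀`-clauses are equivalent: from points to indices specialise at `w := x j`; from indices to
points, a point `w ≠ x i` is either some `x j` (`j ≠ i`) or foreign, at distance `≥ 2`, where
both clauses hold with the far disjunct.  A port of
`CoarseTierTransfer.toFinset_inter_points_image` (same file) to the radial shell; no definition,
no named fact; all `[folklore]`.
-/

noncomputable section

open scoped BigOperators Classical

namespace Summit.AtomisticToContinuum.Crystallization.Theorems

open Literature.MathematicalPhysics.StatisticalMechanics

namespace RdvGappedIff

open CoarseTierTransfer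

-- adapted from Summits/.../ReggeStarCoercivityStarCoercivityCoarseTierTransfer.lean (toFinset_inter_points_image)

variable {N : ℕ} {x : Fin N → EuclideanSpace ℝ (Fin 3)} {P : PeriodicConfiguration 3}

/-- The `x j` are points of a periodic configuration with motif `univ.image x`. [folklore] -/
theorem apply_mem_points (hPm : P.motif = Finset.univ.image x) (j : Fin N) : x j ∈ P.points :=
  P.mem_points_of_mem_motif (by rw [hPm]; exact Finset.mem_image_of_mem x (Finset.mem_univ j))

/-- A point of the long-period periodisation is either some `x j` or at distance `≥ 2` from
`x i`. [folklore] -/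
theorem exists_eq_or_two_le_dist (hPm : P.motif = Finset.univ.image x)
    (hPl : ∀ g ∈ P.lattice, g ≠ 0 → 2 * ∑ k, ‖x k‖ + 2 ≤ ‖g‖) (i : Fin N)
    {w : EuclideanSpace ℝ (Fin 3)} (hw : w ∈ P.points) :
    (∃ j, w = x j) ∨ 2 ≤ dist (x i) w := by
  by_cases h : ∃ j, w = x j
  · exact Or.inl h
  · push Not at h
    exact Or.inr (two_le_dist_of_mem_points hPm hPl i hw h)

/-- **The radial shell read in `P.points` is the image of the index shell.**  For `a ≤ 1` the
points of `P` other than `x i` within `a(1+1/50)` of `x i` are exactly the `x j`, `j ≠ i`, within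
`a(1+1/50)` of `x i` (foreign points are at distance `≥ 2 > 1.02`). [folklore] -/
theorem shell_eq_coe_image (hPm : P.motif = Finset.univ.image x)
    (hPl : ∀ g ∈ P.lattice, g ≠ 0 → 2 * ∑ k, ‖x k‖ + 2 ≤ ‖g‖) (hx : Function.Injective x)
    {a : ℝ} (ha1 : a ≤ 1) (i : Fin N) :
    {w ∈ P.points | w ≠ x i ∧ dist (x i) w ≤ a * (1 + 1 / 50)} =
      ↑((Finset.univ.filter fun j : Fin N => j ≠ i ∧ dist (x i) (x j) ≤ a * (1 + 1 / 50)).image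
        x) := by
  ext w
  simp only [Set.mem_setOf_eq, Finset.coe_image, Finset.coe_filter, Finset.mem_univ, true_and,
    Set.mem_image]
  constructor
  · rintro ⟨hwP, hwi, hwd⟩
    rcases exists_eq_or_two_le_dist hPm hPl i hwP with ⟨j, rfl⟩ | h2
    · exact ⟨j, ⟨fun hji => hwi (by rw [hji]), hwd⟩, rfl⟩
    · exfalso
      linarith
  · rintro ⟨j, ⟨hji, hd⟩, rfl⟩
    exact ⟨apply_mem_points hPm j, fun h => hji (hx h), hd⟩

end RdvGappedIff

open CoarseTierTransfer RdvGappedIff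

/-- **Stub M (bookkeeping) of line `Sketch`, crux `RadialDefectsVanish`.**  For `0 < a ≤ 1`,
site `x i` is gapped-twelve at scale `a` read in the periodisation `P.points` (twelve points of
`P` other than `x i` at distance `≤ a(1+1/50)`; every point of `P` other than `x i` at distance
`≥ a(1-1/50)` and outside the open annulus `(a(1+1/50), 63a/50)`) iff it is gapped-twelve read
in `x`: the points of `P` other than the `x j` are at distance `≥ 2 > 63a/50` from `x i`
(`CoarseTierTransfer.two_le_dist_of_mem_points`), and `x` is injective. [folklore] -/
theorem stub_rdvGappedIff {N : ℕ} {x : Fin N → EuclideanSpace ℝ (Fin 3)}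
    {P : PeriodicConfiguration 3} (hPm : P.motif = Finset.univ.image x)
    (hPl : ∀ g ∈ P.lattice, g ≠ 0 → 2 * ∑ k, ‖x k‖ + 2 ≤ ‖g‖) (hx : Function.Injective x)
    {a : ℝ} (ha : 0 < a) (ha1 : a ≤ 1) (i : Fin N) :
    ({w ∈ P.points | w ≠ x i ∧ dist (x i) w ≤ a * (1 + 1 / 50)}.ncard = 12 ∧
        ∀ w ∈ P.points, w ≠ x i → a * (1 - 1 / 50) ≤ dist (x i) w ∧
          (dist (x i) w ≤ a * (1 + 1 / 50) ∨ a * (63 / 50) ≤ dist (x i) w)) ↔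
      ((Finset.univ.filter fun j : Fin N => j ≠ i ∧ dist (x i) (x j) ≤ a * (1 + 1 / 50)).card = 12 ∧
        ∀ j : Fin N, j ≠ i → a * (1 - 1 / 50) ≤ dist (x i) (x j) ∧
          (dist (x i) (x j) ≤ a * (1 + 1 / 50) ∨ a * (63 / 50) ≤ dist (x i) (x j))) := by
  -- the two thresholds of the far clauses lie below `2` (uses `0 < a ≤ 1`)
  have h126 : a * (63 / 50) ≤ 2 := by linarith
  have h098 : a * (1 - 1 / 50) ≤ 2 :=
    (mul_le_mul_of_nonneg_left (by norm_num) ha.le).trans h126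
  rw [shell_eq_coe_image hPm hPl hx ha1 i, Set.ncard_coe_finset,
    Finset.card_image_of_injective _ hx]
  refine and_congr_right' ⟨fun h j hji => h (x j) (apply_mem_points hPm j) fun e => hji (hx e),
    fun h w hw hwi => ?_⟩
  rcases exists_eq_or_two_le_dist hPm hPl i hw with ⟨j, rfl⟩ | h2
  · exact h j fun hji => hwi (by rw [hji])
  · exact ⟨h098.trans h2, Or.inr (h126.trans h2)⟩

end Summit.AtomisticToContinuum.Crystallization.Theorems

end
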